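import Literature.AnabelianGeometry.EtaleTheta.ContH1Discrete
import Literature.AnabelianGeometry.EtaleTheta.KummerComparison

/-!
# The Kummer class in continuous cohomology, and its comparison with the discrete class

Bridge file of the abc-iut cell (layer L2). [EtTh] §1 works in "the [continuous] group cohomology
of the tempered fundamental group" (PRIMS PDF p. 11) and gets its Kummer classes as "the composite
of the Kummer map `O^×_K̈ → H¹(G_K̈, Δ_Θ)` with the natural map `H¹(G_K̈, Δ_Θ) → H¹(Π^tp_Ÿ, Δ_Θ)`"
[cite: MochizukiEtTh2009, Prop 1.3 p.21], the coefficients `Δ_Θ ≅ Ẑ(1) = Λ(K̄^×)` sitting inside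
`(Π^tp_X)^Θ` and acted on by conjugation. The tree's carrier for this is `ContH1 φ A' H`
(`EtaleTheta/ContH1.lean`: continuous crossed homomorphisms `H → A'`, `A' ≤ G'` abelian normal, `G`
acting by conjugation through `φ : G →* G'`); the Kummer cocycle `h ↦ (h • x_n / x_n)_n ∈ Λ(A)` is
the discrete `RootSystem.kummerCocycle` of `EtaleTheta/KummerClass.lean`
([cite: LANA2026Report, §6.1 p.31]). This file puts the latter into the former:

* `CyclotomeCoefficients φ A' A`: a continuous homomorphism `Λ(A) → A'`, equivariant for the
  `G`-action on `Λ(A)` and conjugation through `φ` on `A'` (in [EtTh] §1: `Ẑ(1) ≅ Δ_Θ`, with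
  `G = Π^tp_X` acting on `A = K̄^×` through `Π^tp_X ↠ G_K`);
* `CyclotomeCoefficients.kummerContCocycle` / `kummerContClass` / `kummerContMap`: the Kummer
  cocycle of a compatible root system with open stabilisers IS a continuous `1`-cocycle
  (`RootSystem.continuous_kummerCocycle`, `KummerComparison.lean`), whence a class in
  `ContH1 φ A' H`, independent of the root system (`kummerContClass_eq`), and the Kummer map
  `A^H → ContH1 φ A' H` of a rootable discrete `G`-module ([cite: Neukirch2013, II §1 p.80]);
* `toDiscreteH1_kummerContClass` / `toDiscreteH1_kummerContMap`: under the (injective,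
  `ContH1.toDiscreteH1_injective`) forgetful map `ContH1.toDiscreteH1` of
  `EtaleTheta/ContH1Discrete.lean`, the continuous Kummer class is the image of the `Λ`-adic class
  `kummerClassOfRootSystem` under the map on `H¹` induced by `Λ(A) → A'` (`H1Map`). With
  `H1ToLevel_kummerClassOfRootSystem` (`KummerComparison.lean`) this puts the [FrdII] level-`N`
  class, the `Λ`-adic class and the continuous class on one line.

Universe: the `ContH1`-valued constructions are universe-polymorphic; statements involving
`invariants` / `groupCohomology.H1` take `G`, `A` in `Type` (Mathlib's multiplicative-cocycle API).
-/

namespace Literature.AnabelianGeometry.EtaleTheta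

open groupCohomology CategoryTheory

/-! ### Coefficient data `Λ(A) → A' ≤ G'` -/

section Coefficients

variable {G G' : Type*} [Group G] [Group G'] [TopologicalSpace G']
  (φ : G →* G') (A' : Subgroup G') [A'.Normal]
  (A : Type*) [CommGroup A] [MulDistribMulAction G A] [TopologicalSpace A]

/-- **Cyclotome coefficients**: a continuous homomorphism `Λ(A) → A'` from the cyclotome of the
`G`-group `A` to an abelian normal subgroup `A' ≤ G'`, equivariant for the action of `G` on `Λ(A)`
and the conjugation action of `G` on `A'` through `φ : G → G'`. This is the shape in which [EtTh] §1
uses Kummer theory: `Λ(K̄^×) = Ẑ(1) ≅ Δ_Θ ⊆ (Π^tp_X)^Θ`, "the composite of the Kummer map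
`O^×_K̈ → H¹(G_K̈, Δ_Θ)` with the natural map …" [cite: MochizukiEtTh2009, Prop 1.3 p.21]. -/
structure CyclotomeCoefficients where
  /-- the homomorphism `Λ(A) → A'` -/
  hom : cyclotome A →* A'
  /-- it is continuous (`Λ(A) ⊆ ∏_n A` with the subspace-of-product topology) -/
  continuous_hom : Continuous hom
  /-- it is `G`-equivariant: `G` acts on `A'` by conjugation through `φ` -/
  hom_smul : ∀ (g : G) (ζ : cyclotome A), hom (g • ζ) = MulAut.conjNormal (φ g) (hom ζ)

end Coefficients

/-! ### The continuous Kummer cocycle and class -/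

section ContClass

variable {G G' : Type*} [Group G] [TopologicalSpace G] [SeparatelyContinuousMul G]
  [Group G'] [TopologicalSpace G'] [IsTopologicalGroup G']
  {φ : G →* G'} {A' : Subgroup G'} [A'.Normal] [IsMulCommutative A']
  {A : Type*} [CommGroup A] [MulDistribMulAction G A] [TopologicalSpace A]
  (c : CyclotomeCoefficients φ A' A) (H : Subgroup G) {a b : A}

namespace CyclotomeCoefficients

/-- **The Kummer cocycle as a continuous `1`-cocycle.** For a compatible root system `x` of the
`H`-invariant `a` whose roots have open stabilisers, `h ↦ c((h • x_n / x_n)_n)` is a member of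
`contCocycles φ A' H`: continuous by `RootSystem.continuous_kummerCocycle`, a crossed homomorphism
by `RootSystem.isMulCocycle₁_kummerCocycle` and the equivariance of `c`.
[cite: MochizukiEtTh2009, Prop 1.3 p.21] -/
def kummerContCocycle (x : RootSystem a) (ha : a ∈ MulAction.fixedPoints H A)
    (hx : ∀ n : ℕ+, IsOpen (MulAction.stabilizer G (x.root n) : Set G)) :
    contCocycles φ A' H :=
  ⟨fun h => c.hom (x.kummerCocycle ha h),
    c.continuous_hom.comp (x.continuous_kummerCocycle ha hx), fun g h => by
      change c.hom (x.kummerCocycle ha (g * h)) =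
        c.hom (x.kummerCocycle ha g) * MulAut.conjNormal (φ (g : G)) (c.hom (x.kummerCocycle ha h))
      rw [x.isMulCocycle₁_kummerCocycle ha g h, map_mul, mul_comm' (c.hom _) (c.hom _),
        ← c.hom_smul]
      rfl⟩

/-- Values of the continuous Kummer cocycle. [cite: MochizukiEtTh2009, Prop 1.3 p.21] -/
@[simp] theorem kummerContCocycle_apply (x : RootSystem a) (ha : a ∈ MulAction.fixedPoints H A)
    (hx : ∀ n : ℕ+, IsOpen (MulAction.stabilizer G (x.root n) : Set G)) (h : H) :
    (c.kummerContCocycle H x ha hx).1 h = c.hom (x.kummerCocycle ha h) := rfl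

/-- **The Kummer class in continuous cohomology** `ContH1 φ A' H` of the `H`-invariant `a`, computed
from the compatible root system `x` (class of `kummerContCocycle`). [cite: MochizukiEtTh2009, Prop 1.3 p.21] -/
def kummerContClass (x : RootSystem a) (ha : a ∈ MulAction.fixedPoints H A)
    (hx : ∀ n : ℕ+, IsOpen (MulAction.stabilizer G (x.root n) : Set G)) : ContH1 φ A' H :=
  ContH1.mk (fun h => c.hom (x.kummerCocycle ha h)) (c.kummerContCocycle H x ha hx).2

/-- The continuous Kummer class does not depend on the compatible root system (two systems differ
by `ζ ∈ Λ(A)`, the cocycles by the coboundary of `c(ζ)`). [cite: MochizukiEtTh2009, Prop 1.3 p.21] -/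
theorem kummerContClass_eq (x y : RootSystem a) (ha : a ∈ MulAction.fixedPoints H A)
    (hx : ∀ n : ℕ+, IsOpen (MulAction.stabilizer G (x.root n) : Set G))
    (hy : ∀ n : ℕ+, IsOpen (MulAction.stabilizer G (y.root n) : Set G)) :
    c.kummerContClass H x ha hx = c.kummerContClass H y ha hy := by
  rw [kummerContClass, kummerContClass, ContH1.mk_eq_mk_iff]
  refine ⟨c.hom (RootSystem.divCyclotome x y), fun h => ?_⟩
  rw [← c.hom_smul, ← map_inv c.hom (x.kummerCocycle ha h), ← map_inv c.hom (x.divCyclotome y),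
    ← map_mul, ← map_mul]
  congr 1
  refine Subtype.ext (funext fun n => ?_)
  change ((h : G) • x.root n / x.root n)⁻¹ * ((h : G) • y.root n / y.root n) =
    (h : G) • (y.root n / x.root n) * (y.root n / x.root n)⁻¹
  rw [smul_div', inv_div, inv_div, div_mul_div_comm, div_mul_div_comm, mul_comm (x.root n)]

/-- The continuous Kummer class of a product, computed with the product root system, is the
product of the classes. [cite: MochizukiEtTh2009, Prop 1.3 p.21] -/
theorem kummerContClass_mul (x : RootSystem a) (y : RootSystem b)
    (ha : a ∈ MulAction.fixedPoints H A) (hb : b ∈ MulAction.fixedPoints H A)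
    (hab : a * b ∈ MulAction.fixedPoints H A)
    (hx : ∀ n : ℕ+, IsOpen (MulAction.stabilizer G (x.root n) : Set G))
    (hy : ∀ n : ℕ+, IsOpen (MulAction.stabilizer G (y.root n) : Set G))
    (hxy : ∀ n : ℕ+, IsOpen (MulAction.stabilizer G ((x.mul y).root n) : Set G)) :
    c.kummerContClass H (x.mul y) hab hxy =
      c.kummerContClass H x ha hx * c.kummerContClass H y hb hy := by
  rw [kummerContClass, kummerContClass, kummerContClass, ContH1.mk_mul_mk]
  exact ContH1.mk_congr H (funext fun h => by
    change c.hom ((x.mul y).kummerCocycle hab h) =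
      c.hom (x.kummerCocycle ha h) * c.hom (y.kummerCocycle hb h)
    rw [RootSystem.kummerCocycle_mul x y ha hb hab, map_mul]) _ _

/-- The continuous Kummer class of `1`, computed with the trivial root system, is trivial.
[cite: MochizukiEtTh2009, Prop 1.3 p.21] -/
theorem kummerContClass_one (h1 : (1 : A) ∈ MulAction.fixedPoints H A)
    (h1' : ∀ n : ℕ+, IsOpen (MulAction.stabilizer G (RootSystem.one.root n : A) : Set G)) :
    c.kummerContClass H RootSystem.one h1 h1' = 1 := by
  rw [kummerContClass, ← ContH1.mk_one]
  refine ContH1.mk_congr H (funext fun h => ?_) _ _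
  change c.hom (RootSystem.one.kummerCocycle h1 h) = 1
  rw [← map_one c.hom]
  congr 1
  refine Subtype.ext (funext fun n => ?_)
  change ((h : G) • (1 : ℕ+ → A) n) / (1 : ℕ+ → A) n = 1
  rw [Pi.one_apply, smul_one, div_one]

end CyclotomeCoefficients

end ContClass

section ContMap

variable {G : Type} {G' : Type*} [Group G] [TopologicalSpace G] [SeparatelyContinuousMul G]
  [Group G'] [TopologicalSpace G'] [IsTopologicalGroup G']
  {φ : G →* G'} {A' : Subgroup G'} [A'.Normal] [IsMulCommutative A']
  {A : Type} [CommGroup A] [MulDistribMulAction G A] [TopologicalSpace A] [RootableBy A ℕ]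
  (c : CyclotomeCoefficients φ A' A) (H : Subgroup G)

namespace CyclotomeCoefficients

/-- **The Kummer map into continuous cohomology** `A^H → ContH1 φ A' H` for a rootable `G`-group
`A` all of whose points have open stabilisers (a discrete `G`-module, [cite: Neukirch2013, II §1 p.80]):
`a ↦` its continuous Kummer class, computed with any compatible root system (`kummerContMap_apply_eq`);
in [EtTh] §1: the Kummer map `K̈^× → H¹(G_K̈, Δ_Θ)` composed with `→ H¹(Π^tp_Ÿ, Δ_Θ)` (p. 21). -/
def kummerContMap (hA : ∀ b : A, IsOpen (MulAction.stabilizer G b : Set G)) :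
    invariants (A := A) H →* ContH1 φ A' H :=
  MonoidHom.mk'
    (fun a => c.kummerContClass H (RootSystem.ofRootableBy (a : A)) a.2 fun _ => hA _)
    fun a b =>
      (c.kummerContClass_eq H (RootSystem.ofRootableBy ((a : A) * (b : A)))
          ((RootSystem.ofRootableBy (a : A)).mul (RootSystem.ofRootableBy (b : A))) (a * b).2
          (fun _ => hA _) fun _ => hA _).trans
        (c.kummerContClass_mul H _ _ a.2 b.2 (a * b).2 (fun _ => hA _) (fun _ => hA _)
          fun _ => hA _)

/-- `kummerContMap` may be computed with any compatible root system.
[cite: MochizukiEtTh2009, Prop 1.3 p.21] -/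
theorem kummerContMap_apply_eq (hA : ∀ b : A, IsOpen (MulAction.stabilizer G b : Set G))
    (a : invariants (A := A) H) (x : RootSystem (a : A)) :
    c.kummerContMap H hA a = c.kummerContClass H x a.2 fun _ => hA _ :=
  c.kummerContClass_eq H (RootSystem.ofRootableBy (a : A)) x a.2 (fun _ => hA _) fun _ => hA _

end CyclotomeCoefficients

end ContMap

/-! ### Forgetting continuity: comparison with the discrete Kummer class -/

section CoefficientsRep

variable {G G' : Type} [Group G] [Group G'] [TopologicalSpace G']
  {φ : G →* G'} {A' : Subgroup G'} [A'.Normal] [IsMulCommutative A'] (H : Subgroup G)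
  {A : Type} [CommGroup A] [MulDistribMulAction G A] [TopologicalSpace A]
  (c : CyclotomeCoefficients φ A' A)

namespace CyclotomeCoefficients

/-- `Λ(A) → A'` is `H`-equivariant into the conjugation module, for every `H ≤ G`.
[cite: MochizukiEtTh2009, Prop 1.3 p.21] -/
theorem of_hom_smul (h : H) (ζ : cyclotome A) :
    ConjCoeff.of φ A' (c.hom (h • ζ)) = h • ConjCoeff.of φ A' (c.hom ζ) := by
  change ConjCoeff.of φ A' (c.hom ((h : G) • ζ)) = (h : G) • ConjCoeff.of φ A' (c.hom ζ)
  rw [c.hom_smul]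
  rfl

/-- `Λ(A) → A'` as a morphism of `ℤ`-linear `H`-representations
`cyclotomeRep H ⟶ Rep.ofMulDistribMulAction H (ConjCoeff φ A')` (Mathlib `Rep`).
[cite: MochizukiEtTh2009, Prop 1.3 p.21] -/
noncomputable def repHom :
    cyclotomeRep (A := A) H ⟶ Rep.ofMulDistribMulAction H (ConjCoeff φ A') :=
  Rep.ofHom
    { toLinearMap :=
        (MonoidHom.toAdditive ((ConjCoeff.of φ A').toMonoidHom.comp c.hom)).toIntLinearMap
      isIntertwining' := fun h =>
        LinearMap.ext fun v => c.of_hom_smul H h (Additive.toMul (α := cyclotome A) v) }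

/-- `repHom` on elements. [cite: MochizukiEtTh2009, Prop 1.3 p.21] -/
@[simp] theorem repHom_hom_apply (v : Additive (cyclotome A)) :
    (c.repHom H).hom v = Additive.ofMul (ConjCoeff.of φ A' (c.hom v.toMul)) := rfl

/-- The map `H¹(H, Λ(A)) ⟶ H¹(H, A')` (discrete group cohomology, Mathlib `groupCohomology.map` in
degree `1`) induced by the coefficients `Λ(A) → A'`. [cite: MochizukiEtTh2009, Prop 1.3 p.21] -/
noncomputable abbrev H1Map :
    H1 (cyclotomeRep (A := A) H) ⟶ H1 (Rep.ofMulDistribMulAction H (ConjCoeff φ A')) :=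
  groupCohomology.map (MonoidHom.id H) (c.repHom H) 1

end CyclotomeCoefficients

end CoefficientsRep

section ContComparison

variable {G G' : Type} [Group G] [TopologicalSpace G] [SeparatelyContinuousMul G]
  [Group G'] [TopologicalSpace G'] [IsTopologicalGroup G']
  {φ : G →* G'} {A' : Subgroup G'} [A'.Normal] [IsMulCommutative A'] (H : Subgroup G)
  {A : Type} [CommGroup A] [MulDistribMulAction G A] [TopologicalSpace A]
  (c : CyclotomeCoefficients φ A' A) {a : A}

namespace CyclotomeCoefficients

/-- **Comparison of the continuous and the discrete Kummer class.** Forgetting continuity, the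
Kummer class in `ContH1 φ A' H` is the image of the `Λ`-adic Kummer class
`kummerClassOfRootSystem H x ha ∈ H¹(H, Λ(A))` ([cite: LANA2026Report, §6.1 p.31]) under the map on
`H¹` induced by the coefficients `Λ(A) → A'`. -/
theorem toDiscreteH1_kummerContClass (x : RootSystem a) (ha : a ∈ MulAction.fixedPoints H A)
    (hx : ∀ n : ℕ+, IsOpen (MulAction.stabilizer G (x.root n) : Set G)) :
    (ContH1.toDiscreteH1 φ A' H (c.kummerContClass H x ha hx)).toAdd =
      c.H1Map H (kummerClassOfRootSystem H x ha) := by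
  rw [kummerContClass, ContH1.toDiscreteH1_mk, toAdd_ofAdd, kummerClassOfRootSystem, H1Map,
    H1π_comp_map_apply]
  congr 1

variable [RootableBy A ℕ]

/-- The same comparison for the Kummer maps: forgetting continuity, `kummerContMap` is the
`Λ`-adic Kummer map `kummerClass` ([cite: LANA2026Report, §6.1 p.31]) followed by the map on `H¹`
induced by `Λ(A) → A'`. -/
theorem toDiscreteH1_kummerContMap (hA : ∀ b : A, IsOpen (MulAction.stabilizer G b : Set G))
    (a : invariants (A := A) H) :
    (ContH1.toDiscreteH1 φ A' H (c.kummerContMap H hA a)).toAdd = c.H1Map H (kummerClass H a) := by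
  rw [c.kummerContMap_apply_eq H hA a (RootSystem.ofRootableBy (a : A)), kummerClass]
  exact c.toDiscreteH1_kummerContClass H _ a.2 _

end CyclotomeCoefficients

end ContComparison

end Literature.AnabelianGeometry.EtaleTheta
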